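import Mathlib
import Literature.AlgebraicGeometry.Ramification.InertiaNormalSylow
import Literature.RingTheory.CompleteLocalRings.TameAutomorphismCotangent
import Summits.ResolutionOfSingularities.ResolutionOfSingularities.Theorems.WildQuotientsWildQuotientResolutionStubBorelCore
import Summits.ResolutionOfSingularities.ResolutionOfSingularities.Theorems.WildQuotientsWildQuotientResolutionStubFlagCore
import Summits.ResolutionOfSingularities.ResolutionOfSingularities.Theorems.WildQuotientsWildQuotientResolutionUnipotentLevel
import HarnessLib

/-!
# A faithful residue-trivial action stabilising a COMPLETE FLAG of the cotangent space is p-closed — any embedding dimension (crux `WildQuotients.WildQuotientResolution`, Phase 0)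

Crux stmt-ResolutionOfSingularities-15640 (`WildQuotientResolution`), line `Sketch` (card
`p-closure-sylow-separation`), registered stub `stub_phaseZeroHighDim` (= PhaseZeroModel for
`dim X′ ≥ 3`: a `G`-equivariant proper birational REGULAR model on which every inertia group is
p-closed). The local algebra of Phase 0 landed so far is dimension-bound:
`BorelCore.stub_borelCore` (`Theorems/…StubBorelCore.lean`) is the case `dim 𝔪/𝔪² ≤ 2` (one
point blow-up of a surface: the inertia upstairs fixes a LINE of the plane `𝔪/𝔪²`, so lies in a
Borel subgroup of `GL₂`), and `FlagCore.stub_flagCore` (`Theorems/…StubFlagCore.lean`) is the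
one-step case `dim J̄ ≤ 2`, `codim J̄ ≤ 1` (a flag of length three, unipotent level three,
`g ^ (p ^ 2)`). This file removes the dimension bound from the GROUP-THEORETIC END of the
argument, which every higher-dimensional Phase 0 strategy (towers of equivariant blow-ups until the
inertia stabilises a full flag of the cotangent space) must finish with:

**Theorem** (`hasNormalSylow_of_flag`). Let `(R, 𝔪, κ)` be a Noetherian local ring of residue
characteristic `p` and `τ` a faithful residue-trivial action of a finite group `I` on `R`. If `I`
stabilises a chain of ideals `𝔪² = K₀ ≤ K₁ ≤ ⋯ ≤ K_n = 𝔪` (between `𝔪²` and `𝔪`, i.e. a flag of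
subspaces of `V = 𝔪/𝔪²`) whose successive steps are LINES (`K_{i+1} = K_i + R v_i` modulo `K_i`),
then `I` has a normal Sylow `p`-subgroup.

Proof. Each line `K_{i+1}/K_i` carries a character `ν_i : I → κˣ`
(`FlagCore.exists_character_of_line`); `U := ⋂ ker ν_i = ker (ν_0, …, ν_{n-1})`, a homomorphism to
the Pi-group `ℕ → κˣ`, which has no element of order `p`
(`UnipotentLevel.pi_eq_one_of_pow_eq_one`, `BorelCore.units_eq_one_of_pow_char_eq_one`). An
element `g ∈ U` is unipotent of level `n` on `V`: its difference operator `δ = τ g − 1` maps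
`K_{i+1}` into `K_i`, so `δ^[n] 𝔪 ⊆ 𝔪²` (`UnipotentLevel.iterate_sub_mem_of_flag`), and by the
binomial step in arbitrary level (`UnipotentLevel.cotangentTrivial_pow_of_iterate_sub`, `n < p ^ n`)
`g ^ (p ^ n)` acts trivially on `𝔪/𝔪²`. Hence `U` is a `p`-group of index prime to `p`
(`FlagCore.hasNormalSylow_of_character`, whose engine is
`BorelCore.exists_pow_eq_one_of_cotangentTrivial`).

[OURS · crux stmt-ResolutionOfSingularities-15640 · helper toward `stub_phaseZeroHighDim`; folklore
group theory / local algebra, counted 0; AI-level work, weaker than expert review.]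

* `hasNormalSylow_of_flag` — the theorem.
-/

-- single-problem summit: the doubled namespace component `ResolutionOfSingularities` is forced
set_option linter.dupNamespace false

open IsLocalRing Literature.AlgebraicGeometry.Ramification Literature.RingTheory.CompleteLocalRings
open Summit.ResolutionOfSingularities.ResolutionOfSingularities.Theorems.WildQuotientResolution.BorelCore
open Summit.ResolutionOfSingularities.ResolutionOfSingularities.Theorems.WildQuotientResolution.FlagCore
open Summit.ResolutionOfSingularities.ResolutionOfSingularities.Theorems.WildQuotientResolution.UnipotentLevel

namespace Summit.ResolutionOfSingularities.ResolutionOfSingularities.Theorems.WildQuotientResolution.FlagCoreGeneral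

variable {R : Type*} [CommRing R] [IsLocalRing R] {I : Type*} [Group I]

/-- **A faithful residue-trivial action stabilising a complete flag of `𝔪/𝔪²` is p-closed** (the
group-theoretic end of Phase 0 in ARBITRARY embedding dimension; crux
stmt-ResolutionOfSingularities-15640, toward `stub_phaseZeroHighDim`). Let `(R, 𝔪, κ)` be a
Noetherian local ring of residue characteristic `p`, `τ` a faithful residue-trivial action of the
finite group `I` on `R`, and `K : ℕ → Ideal R` a `τ`-stable chain with `K 0 ≤ 𝔪²`, `𝔪 ≤ K n`,
`𝔪² ≤ K i ≤ 𝔪` for all `i` (indices `i > n` are idle: put `K i = 𝔪` there), each step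
`K (i + 1) ⊇ K i` a LINE modulo `K i` for `i < n` (`∃ v ∈ K (i+1), ∀ r ∈ K (i+1), ∃ a, r - a v ∈ K i`;
a step may also be trivial). Then `I` has a normal Sylow `p`-subgroup: the common kernel of the
`n` characters of `I` on the lines `K (i+1) / K i` (`FlagCore.exists_character_of_line`) is a
normal `p`-subgroup (`UnipotentLevel.cotangentTrivial_pow_of_iterate_sub` with `N = n`,
`n < p ^ n`, and `BorelCore.exists_pow_eq_one_of_cotangentTrivial`) of index prime to `p`
(`FlagCore.hasNormalSylow_of_character` with the Pi-group `ℕ → κˣ`). `BorelCore.stub_borelCore`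
and `FlagCore.stub_flagCore` are the flags of length `2` and `3` produced by one blow-up.
[folklore] -/
theorem hasNormalSylow_of_flag (p : ℕ) [Fact p.Prime] [IsNoetherianRing R]
    [CharP (ResidueField R) p] [Finite I] {τ : I →* (R ≃+* R)} (hτ : Function.Injective τ)
    (hres : ∀ (g : I) (r : R), τ g r - r ∈ maximalIdeal R)
    (n : ℕ) (K : ℕ → Ideal R)
    (hK0 : K 0 ≤ maximalIdeal R ^ 2) (hKn : maximalIdeal R ≤ K n)
    (hK2 : ∀ i, maximalIdeal R ^ 2 ≤ K i) (hKm : ∀ i, K i ≤ maximalIdeal R)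
    (hKτ : ∀ (g : I) (i : ℕ), ∀ x ∈ K i, τ g x ∈ K i)
    (hline : ∀ i < n, ∃ v ∈ K (i + 1), ∀ r ∈ K (i + 1), ∃ a : R, r - a * v ∈ K i) :
    HasNormalSylow p I := by
  classical
  have hp : p.Prime := Fact.out
  -- the characters of `I` on the lines of the flag (`ν i = 1` for the idle indices `i ≥ n`)
  have hchar : ∀ i : ℕ, ∃ ν : I →* (ResidueField R)ˣ,
      i < n → ∀ g, ν g = 1 → ∀ r ∈ K (i + 1), τ g r - r ∈ K i := by
    intro i
    by_cases hi : i < n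
    · obtain ⟨v, hv, hgen⟩ := hline i hi
      obtain ⟨ν, hν⟩ := exists_character_of_line τ hres (L := (K (i + 1) : Set R))
        (fun r hr => hKm _ hr) (fun g r hr => hKτ g _ r hr) (K i) (fun g x hx => hKτ g i x hx)
        (hK2 i) hv hgen
      exact ⟨ν, fun _ => hν⟩
    · exact ⟨1, fun h => absurd h hi⟩
  choose ν hν using hchar
  have hp_mem : (p : R) ∈ maximalIdeal R := by
    rw [← residue_eq_zero_iff, map_natCast, CharP.cast_eq_zero]
  refine hasNormalSylow_of_character p hτ hres (A := ℕ → (ResidueField R)ˣ)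
    (pi_eq_one_of_pow_eq_one fun _ a h => units_eq_one_of_pow_char_eq_one p h)
    (MonoidHom.pi ν) n fun g hg => ?_
  -- `g` in the common kernel lowers the flag by one step, hence is unipotent of level `n`
  have hg1 : ∀ i, ν i g = 1 := fun i => by
    have h := congrFun hg i
    rwa [MonoidHom.pi_apply, Pi.one_apply] at h
  have hstep : ∀ i < n, ∀ r ∈ K (i + 1), τ g r - r ∈ K i := fun i hi => hν i hi g (hg1 i)
  rw [map_pow]
  exact cotangentTrivial_pow_of_iterate_sub p (τ g) (hres g) hp_mem (n.lt_pow_self hp.one_lt).le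
    fun r hr => hK0 (iterate_sub_mem_of_flag (τ g) n K hstep n 0 (by omega) r
      (by rw [zero_add]; exact hKn hr))

end Summit.ResolutionOfSingularities.ResolutionOfSingularities.Theorems.WildQuotientResolution.FlagCoreGeneral
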